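import Summits.CriticalPhenomena.CardyFormulaZ2.Theorems.CardyComplexConeEdgePrecompactUFRSHalfPlaneArmsReimer
import Literature.Probability.Percolation.KSTPeriodicCorridor

/-!
# Thin slab crossings: the third certificate (CRAWL) of the corrected three-strands dichotomy
(line `qkz-strip-boundary-arm` of crux `CardyComplexCone.EdgePrecompact`, stmt-CriticalPhenomena-11387;
vocabulary of the CORRECTED dichotomy behind the flat three-strand decay HT for mixed tags —
worker W-HT5 of lead c5, wave 5; the registered `ufrs_rect_threeStrands_dichotomy` of wave 4 is
false: a strand of the inner completion may touch its wired row at `ω`-closed edges DENSELY, and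
then no two-colour loose-arm certificate exists at any scale)

When the selected strand CRAWLS along the wired (resp. free) row of the inner completion — its
chain between radial distances `A` and `6A/5` stays within `ε A` of the row (this is what the
touchdown trichotomy `crawl_trichotomy_HT5` of `…UFRSCrawlTrichotomy.lean` extracts when neither
GOOD nor a valid coincidence point exists) — its right walk (resp. left walk) is a GENUINE dual
(resp. open) crossing, the long way, of a thin slab of aspect ratio `≍ 1/ε` along the row. These
are the events of this file, in lattice-frame coordinates like `hpLooseArms`:

* `thinDualCrossing a a' b' b lo hi` — a face walk inside the slab `[a, b] × [lo, hi]` from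
  abscissa `≤ a'` to abscissa `≥ b'`, every step crossing an `ω`-CLOSED edge (`sepEdge`);
* `thinOpenCrossing a a' b' b lo hi` — a site walk inside the slab from abscissa `≤ a'` to
  abscissa `≥ b'` along `ω`-OPEN edges;
* `slabSites a b lo hi = [a-1, b+1] × [lo-1, hi+2]` carries both events (`determinedBy_thin*`),
  and their probability is frame invariant (`real_preimage_relabel_thin*`).

The probabilistic input they call for (to be proved with the corridor/duality machinery of
`Literature/Probability/Percolation/KSTPeriodicCorridor.lean`, `BoxCrossing*.lean`): a crossing
of the slab the long way has probability `≤ 2^{-⌊(b'-a')/(hi-lo+2)⌋}` (independent blocks of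
width `hi-lo+2`, each crossed the short way by the dual colour with probability `≥ 1/2`).

References: H. Kesten, *Percolation theory for mathematicians* (1982), §6.3 (crossings of long
rectangles); G. Grimmett, *Percolation* (1999), §11.3; G. F. Lawler, O. Schramm, W. Werner,
Electron. J. Probab. 7 (2002), App. A.
(buildfix 2026-08-20: comment-only re-land to re-enqueue the module build after its blocking imports were repaired; no declaration changed.)
-/

namespace Summit.CriticalPhenomena.CardyFormulaZ2.Cruxes.EdgePrecompact.QkzStripBoundaryArm

open MeasureTheory Filter Set Metric
open scoped Topology BigOperators Pointwise
open Literature.Probability.LatticeModels Literature.Probability.Percolation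
open Literature.Probability.RandomPlanarGeometry (DobrushinDomain)
open Summit.CriticalPhenomena.CardyFormulaZ2.Theses.CardyComplexCone

noncomputable section

/-! ## The events -/

/-- **A thin dual crossing**: a face walk inside the slab `[a, b] × [lo, hi]` from a face of
abscissa `≤ a'` to a face of abscissa `≥ b'`, each of whose steps crosses an `ω`-closed edge. -/
def thinDualCrossing (a a' b' b lo hi : ℤ) : Set (BondConfig (Site 2)) :=
  {ω | ∃ (x y : Site 2) (W : (zdGraph 2).Walk x y), x 0 ≤ a' ∧ b' ≤ y 0 ∧
    (∀ u ∈ W.support, a ≤ u 0 ∧ u 0 ≤ b ∧ lo ≤ u 1 ∧ u 1 ≤ hi) ∧ ∀ d ∈ W.darts, sepEdge d.fst d.snd ∉ ω}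

/-- **A thin open crossing**: a site walk inside the slab `[a, b] × [lo, hi]` from a site of
abscissa `≤ a'` to a site of abscissa `≥ b'` along `ω`-open edges. -/
def thinOpenCrossing (a a' b' b lo hi : ℤ) : Set (BondConfig (Site 2)) :=
  {ω | ∃ (x y : Site 2) (W : (zdGraph 2).Walk x y), x 0 ≤ a' ∧ b' ≤ y 0 ∧
    (∀ u ∈ W.support, a ≤ u 0 ∧ u 0 ≤ b ∧ lo ≤ u 1 ∧ u 1 ≤ hi) ∧ ∀ e ∈ W.edges, e ∈ ω}

/-- Membership in `thinDualCrossing`, unfolded (registered anchor `mem_thinDualCrossing_iff`; by `Iff.rfl`). -/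
theorem mem_thinDualCrossing_iff : ∀ (a a' b' b lo hi : ℤ) (ω : BondConfig (Site 2)), ω ∈ thinDualCrossing a a' b' b lo hi ↔ ∃ (x y : Site 2) (W : (zdGraph 2).Walk x y), x 0 ≤ a' ∧ b' ≤ y 0 ∧ (∀ u ∈ W.support, a ≤ u 0 ∧ u 0 ≤ b ∧ lo ≤ u 1 ∧ u 1 ≤ hi) ∧ ∀ d ∈ W.darts, sepEdge d.fst d.snd ∉ ω :=
  fun _ _ _ _ _ _ _ => Iff.rfl

/-- Membership in `thinOpenCrossing`, unfolded (by `Iff.rfl`). -/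
theorem mem_thinOpenCrossing_iff : ∀ (a a' b' b lo hi : ℤ) (ω : BondConfig (Site 2)), ω ∈ thinOpenCrossing a a' b' b lo hi ↔ ∃ (x y : Site 2) (W : (zdGraph 2).Walk x y), x 0 ≤ a' ∧ b' ≤ y 0 ∧ (∀ u ∈ W.support, a ≤ u 0 ∧ u 0 ≤ b ∧ lo ≤ u 1 ∧ u 1 ≤ hi) ∧ ∀ e ∈ W.edges, e ∈ ω :=
  fun _ _ _ _ _ _ _ => Iff.rfl

/-! ## Frame invariance -/

/-- Frame invariance of the thin dual crossing (`bondPercolation_real_preimage_relabel_iso`). -/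
theorem real_preimage_relabel_thinDualCrossing (φ : zdGraph 2 ≃g zdGraph 2) (a a' b' b lo hi : ℤ) :
    (bondPercolation (zdGraph 2) half).real (BondConfig.relabel (sym2Equiv φ.toEquiv) ⁻¹' thinDualCrossing a a' b' b lo hi) =
      (bondPercolation (zdGraph 2) half).real (thinDualCrossing a a' b' b lo hi) :=
  bondPercolation_real_preimage_relabel_iso φ half _

/-- Frame invariance of the thin open crossing. -/
theorem real_preimage_relabel_thinOpenCrossing (φ : zdGraph 2 ≃g zdGraph 2) (a a' b' b lo hi : ℤ) :
    (bondPercolation (zdGraph 2) half).real (BondConfig.relabel (sym2Equiv φ.toEquiv) ⁻¹' thinOpenCrossing a a' b' b lo hi) =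
      (bondPercolation (zdGraph 2) half).real (thinOpenCrossing a a' b' b lo hi) :=
  bondPercolation_real_preimage_relabel_iso φ half _

/-! ## Locality -/

/-- The sites carrying the thin crossing events of the slab `[a, b] × [lo, hi]`: `[a-1, b+1] × [lo-1, hi+1]`. -/
def slabSites (a b lo hi : ℤ) : Finset (Site 2) :=
  Finset.Icc ![a - 1, lo - 1] ![b + 1, hi + 1]

/-- Membership in `slabSites`, in coordinates. -/
theorem mem_slabSites {a b lo hi : ℤ} {w : Site 2} :
    w ∈ slabSites a b lo hi ↔ (a - 1 ≤ w 0 ∧ w 0 ≤ b + 1) ∧ (lo - 1 ≤ w 1 ∧ w 1 ≤ hi + 1) := by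
  rw [slabSites, Finset.mem_Icc, Pi.le_def, Pi.le_def, Fin.forall_fin_two, Fin.forall_fin_two]
  simp only [Matrix.cons_val_zero, Matrix.cons_val_one]
  tauto

/-- Slab sites are `slabSites`. -/
theorem mem_slabSites_of_slab {a b lo hi : ℤ} {u : Site 2} (hu : a ≤ u 0 ∧ u 0 ≤ b ∧ lo ≤ u 1 ∧ u 1 ≤ hi) :
    u ∈ slabSites a b lo hi :=
  mem_slabSites.2 ⟨⟨by omega, by omega⟩, by omega, by omega⟩

/-- The edge crossed by a step between slab faces is a pair of `slabSites`. -/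
theorem sepEdge_mem_sym2_slabSites {a b lo hi : ℤ} {f f' : Site 2} (h : (zdGraph 2).Adj f f')
    (hf : a ≤ f 0 ∧ f 0 ≤ b ∧ lo ≤ f 1 ∧ f 1 ≤ hi) :
    sepEdge f f' ∈ (↑(slabSites a b lo hi).sym2 : Set (Sym2 (Site 2))) := by
  rw [Finset.mem_coe, Finset.mem_sym2_iff]
  intro w hw
  have := KSTPeriodic.sepEdge_subset_face h hw
  exact mem_slabSites.2 ⟨⟨by omega, by omega⟩, by omega, by omega⟩

/-- One direction of locality for the thin dual crossing. -/
theorem mem_thinDualCrossing_of_inter_eq {a a' b' b lo hi : ℤ} {ω ω' : BondConfig (Site 2)}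
    (h : ω ∩ ↑(slabSites a b lo hi).sym2 = ω' ∩ ↑(slabSites a b lo hi).sym2)
    (hω : ω ∈ thinDualCrossing a a' b' b lo hi) : ω' ∈ thinDualCrossing a a' b' b lo hi := by
  obtain ⟨x, y, W, hx, hy, hslab, hcl⟩ := hω
  refine ⟨x, y, W, hx, hy, hslab, fun d hd hd' => hcl d hd ?_⟩
  have hmem := sepEdge_mem_sym2_slabSites d.adj (hslab _ (W.dart_fst_mem_support_of_mem_darts hd))
  exact ((Set.ext_iff.1 h _).2 ⟨hd', hmem⟩).1

/-- One direction of locality for the thin open crossing. -/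
theorem mem_thinOpenCrossing_of_inter_eq {a a' b' b lo hi : ℤ} {ω ω' : BondConfig (Site 2)}
    (h : ω ∩ ↑(slabSites a b lo hi).sym2 = ω' ∩ ↑(slabSites a b lo hi).sym2)
    (hω : ω ∈ thinOpenCrossing a a' b' b lo hi) : ω' ∈ thinOpenCrossing a a' b' b lo hi := by
  obtain ⟨x, y, W, hx, hy, hslab, hop⟩ := hω
  refine ⟨x, y, W, hx, hy, hslab, fun e he => ?_⟩
  have hmem : e ∈ (↑(slabSites a b lo hi).sym2 : Set (Sym2 (Site 2))) := by
    induction e using Sym2.ind with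
    | _ s t =>
      rw [Finset.mem_coe, Finset.mk_mem_sym2_iff]
      exact ⟨mem_slabSites_of_slab (hslab _ (W.fst_mem_support_of_mem_edges he)),
        mem_slabSites_of_slab (hslab _ (W.snd_mem_support_of_mem_edges he))⟩
  exact ((Set.ext_iff.1 h e).1 ⟨hop e he, hmem⟩).1

/-- **The thin dual crossing is local** (read off the pairs of `slabSites`). -/
theorem determinedBy_thinDualCrossing (a a' b' b lo hi : ℤ) :
    DeterminedBy (thinDualCrossing a a' b' b lo hi) ↑(slabSites a b lo hi).sym2 := by
  rw [determinedBy_iff]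
  exact fun ω ω' h => ⟨mem_thinDualCrossing_of_inter_eq h, mem_thinDualCrossing_of_inter_eq h.symm⟩

/-- **The thin open crossing is local**. -/
theorem determinedBy_thinOpenCrossing (a a' b' b lo hi : ℤ) :
    DeterminedBy (thinOpenCrossing a a' b' b lo hi) ↑(slabSites a b lo hi).sym2 := by
  rw [determinedBy_iff]
  exact fun ω ω' h => ⟨mem_thinOpenCrossing_of_inter_eq h, mem_thinOpenCrossing_of_inter_eq h.symm⟩

/-- The thin crossing events are measurable, in every frame. -/
theorem measurableSet_preimage_thinCrossing (φ : zdGraph 2 ≃g zdGraph 2) (a a' b' b lo hi : ℤ) :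
    MeasurableSet (BondConfig.relabel (sym2Equiv φ.toEquiv) ⁻¹' (thinDualCrossing a a' b' b lo hi ∪ thinOpenCrossing a a' b' b lo hi)) :=
  (((determinedBy_thinDualCrossing a a' b' b lo hi).measurableSet_of_finset).union
    ((determinedBy_thinOpenCrossing a a' b' b lo hi).measurableSet_of_finset)).preimage (BondConfig.relabel _).measurable

/-! ## Elementary properties -/

/-- Reversing the walk: a thin dual crossing may equally be given from right to left. -/
theorem mem_thinDualCrossing_of_reverse {a a' b' b lo hi : ℤ} {ω : BondConfig (Site 2)} {x y : Site 2}
    (W : (zdGraph 2).Walk x y) (hx : b' ≤ x 0) (hy : y 0 ≤ a')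
    (hslab : ∀ u ∈ W.support, a ≤ u 0 ∧ u 0 ≤ b ∧ lo ≤ u 1 ∧ u 1 ≤ hi) (hcl : ∀ d ∈ W.darts, sepEdge d.fst d.snd ∉ ω) :
    ω ∈ thinDualCrossing a a' b' b lo hi := by
  refine ⟨y, x, W.reverse, hy, hx, fun u hu => hslab u ?_, fun d hd => ?_⟩
  · rwa [SimpleGraph.Walk.support_reverse, List.mem_reverse] at hu
  · rw [SimpleGraph.Walk.darts_reverse, List.mem_reverse, List.mem_map] at hd
    obtain ⟨d', hd', rfl⟩ := hd
    rw [SimpleGraph.Dart.symm_toProd, Prod.fst_swap, Prod.snd_swap, sepEdge_comm]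
    exact hcl d' hd'

/-- Reversing the walk: a thin open crossing may equally be given from right to left. -/
theorem mem_thinOpenCrossing_of_reverse {a a' b' b lo hi : ℤ} {ω : BondConfig (Site 2)} {x y : Site 2}
    (W : (zdGraph 2).Walk x y) (hx : b' ≤ x 0) (hy : y 0 ≤ a')
    (hslab : ∀ u ∈ W.support, a ≤ u 0 ∧ u 0 ≤ b ∧ lo ≤ u 1 ∧ u 1 ≤ hi) (hop : ∀ e ∈ W.edges, e ∈ ω) :
    ω ∈ thinOpenCrossing a a' b' b lo hi := by
  refine ⟨y, x, W.reverse, hy, hx, fun u hu => hslab u ?_, fun e he => hop e ?_⟩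
  · rwa [SimpleGraph.Walk.support_reverse, List.mem_reverse] at hu
  · rwa [SimpleGraph.Walk.edges_reverse, List.mem_reverse] at he

/-- The slab may be enlarged. -/
theorem thinDualCrossing_mono {a a' b' b lo hi A B LO HI : ℤ} (ha : A ≤ a) (hb : b ≤ B) (hlo : LO ≤ lo) (hhi : hi ≤ HI) :
    thinDualCrossing a a' b' b lo hi ⊆ thinDualCrossing A a' b' B LO HI := by
  rintro ω ⟨x, y, W, hx, hy, hslab, hcl⟩
  exact ⟨x, y, W, hx, hy, fun u hu => by have := hslab u hu; omega, hcl⟩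

/-- The slab may be enlarged. -/
theorem thinOpenCrossing_mono {a a' b' b lo hi A B LO HI : ℤ} (ha : A ≤ a) (hb : b ≤ B) (hlo : LO ≤ lo) (hhi : hi ≤ HI) :
    thinOpenCrossing a a' b' b lo hi ⊆ thinOpenCrossing A a' b' B LO HI := by
  rintro ω ⟨x, y, W, hx, hy, hslab, hop⟩
  exact ⟨x, y, W, hx, hy, fun u hu => by have := hslab u hu; omega, hop⟩

end

end Summit.CriticalPhenomena.CardyFormulaZ2.Cruxes.EdgePrecompact.QkzStripBoundaryArm
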